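import Summits.CriticalPhenomena.PercolationContinuityZ3.Theorems.PercNearOneGluingNoHeavyLowerTailSahiTransportJRSound
import Summits.CriticalPhenomena.PercolationContinuityZ3.Theorems.PercNearOneGluingNoHeavyLowerTailSahiTransportJR3Sound
import Summits.CriticalPhenomena.PercolationContinuityZ3.Theorems.PercNearOneGluingNoHeavyLowerTailSahiTransportJREval4A
import Summits.CriticalPhenomena.PercolationContinuityZ3.Theorems.PercNearOneGluingNoHeavyLowerTailSahiTransportJREval4B
import Summits.CriticalPhenomena.PercolationContinuityZ3.Theorems.PercNearOneGluingNoHeavyLowerTailSahiTransportJREval4C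
import Summits.CriticalPhenomena.PercolationContinuityZ3.Theorems.PercNearOneGluingNoHeavyLowerTailSahiTransportJREval4D
import Summits.CriticalPhenomena.PercolationContinuityZ3.Theorems.PercNearOneGluingNoHeavyLowerTailSahiTransportJREval4E
import Summits.CriticalPhenomena.PercolationContinuityZ3.Theorems.PercNearOneGluingNoHeavyLowerTailSahiTransportJREval4F
import Summits.CriticalPhenomena.PercolationContinuityZ3.Theorems.PercNearOneGluingNoHeavyLowerTailSahiTransportJR3Eval4
import Summits.CriticalPhenomena.PercolationContinuityZ3.Theorems.PercNearOneGluingNoHeavyLowerTailSahiTransportRho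
import Summits.CriticalPhenomena.PercolationContinuityZ3.Theorems.PercNearOneGluingNoHeavyLowerTailSahiJuntaSlotLeThree

/-!
# `NoHeavyLowerTail` (crux stmt-CriticalPhenomena-4575): KAHN'S CONJECTURE 5 / SAHI'S `C₃` WHENEVER ONE OF THE THREE INCREASING EVENTS DEPENDS ON
# AT MOST FOUR COORDINATES

Support file (cell `prim-l12`, seat P3 = Ahlswede–Daykin / transport certificates, gen 5; `--supports stmt-CriticalPhenomena-4575`).  No `sorry`, no named
facts; computational (the certificate evaluations it imports are `native_decide` facts).  New mathematics, not in print.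

**THEOREM** (`sahiE_three_nonneg_of_determinedBy_card_le_four`, law form `prodBernoulli_sahiE3_nonneg_of_determinedBy_card_le_four`).  For every finite
`ι`, every product weight `μ_p` on `2^ι`, every `A ⊆ ι` with `|A| ≤ 4`, every increasing event `H` determined by `A`, and ALL increasing events `U, V`:
`E₃(1_H, 1_U, 1_V) = 2μ(HUV) − μ(HU)μ(V) − μ(HV)μ(U) − μ(UV)μ(H) + μ(H)μ(U)μ(V) ≥ 0`.
Kahn [Kahn2022, Conj. 5] / Sahi [Sahi2008, Conj. 5] conjecture this for three arbitrary increasing events (open; "thoroughly intractable"); the tree had it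
for `|A| ≤ 3` (`…SahiJuntaSlotLeThree`) and for the whole cube `{0,1}^m`, `m ≤ 4` (`…SahiC3CombCubeFour`).  Here the other two events live in ANY dimension.

PROOF = the transport-certificate method (`…SahiTransportCert`: a certificate on the pattern cube `2^4` of the first slot bounds `E₃` below by a bilinear
form in the outer sections, nonnegative by the cone lemma) with PARAMETER-FREE certificates: for each of the `166` nontrivial increasing pattern events
`M` of `2^4` a table `c(η,ζ,T)` (two independent samples `η ~ μ(·|Hᶜ)`, `ζ ~ μ(·|H)`; the JOIN–REDUCE rule for `139` events, deterministic LP tables for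
the `24` masks of types `P₄`/triangle-plus-pendant) or `c(η,ζ,ξ,T)` (a third sample `ξ ~ μ`; the `3` masks of type `K₂,₂`) whose every capacity row and
every transport row — polynomials of multidegree `≤ 3` in `(p_a,p_b,p_c,p_d)` — has all `256` degree-3 tensor-Bernstein coefficients nonnegative,
checked in the kernel as base-`2^σ` digits of Kronecker numbers (`…SahiTransportJREval4A–F`, `…SahiTransportJR3Eval4`), made into `TransportCert`s by
`…SahiTransportJRSound` / `…SahiTransportJR3Sound` (Strassen coupling), plus the trivial events (`…SahiTransportRho.transportCert_empty/univ`).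
[cite: Kahn2022, Conj. 5 (arXiv p. 3); Sahi2008, Conj. 5; LiebSahi2021, eq. (2.1)]
-/

noncomputable section

open scoped Classical

namespace Summit.CriticalPhenomena.PercolationContinuityZ3.Theorems.SahiTransportJR

open Finset SahiHittingSlot SahiTransportCert SahiC3Cube SahiJuntaSlotThree Literature.Combinatorics.Sahi2008
open Literature.Probability.LatticeModels (prodBernoulli sahiE3)
open Literature.Probability.Percolation (DeterminedBy determinedBy_iff)
open Literature.Probability.Percolation.DecisionTree (ind ind_of_mem ind_of_not_mem ind_nonneg)

variable {ι : Type} [Fintype ι]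

/-- Every nontrivial increasing bitmask of `2^4` lies in one of the certified batches. [this work] -/
theorem cover4 : ((upsN 4).all fun M => decide (M = 0) || decide (M = 65535) || decide (M ∈ batch4A) || decide (M ∈ batch4B) ||
    decide (M ∈ batch4C) || decide (M ∈ batch4D) || decide (M ∈ batch4E) || decide (M ∈ batch4F) || decide (M ∈ batch4K22)) = true := by
  native_decide

/-- An event with the zero bitmask is empty. [this work] -/
theorem eq_empty_of_encA_eq_zero {m : ℕ} {P : Set (Set (Fin m))} (h : encA m P = 0) : P = ∅ := by
  ext S
  simp only [Set.mem_empty_iff_false, iff_false]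
  intro hS
  have := (mem_iff_testBit_encA P S).1 hS
  rw [h, Nat.zero_testBit] at this
  exact Bool.false_ne_true this

/-- An event of `2^4` with the full bitmask is everything. [this work] -/
theorem eq_univ_of_encA_eq_full {P : Set (Set (Fin 4))} (h : encA 4 P = 65535) : P = Set.univ := by
  ext S
  simp only [Set.mem_univ, iff_true]
  rw [mem_iff_testBit_encA P S, h]
  have h1 : (65535 : ℕ) = 2 ^ 16 - 1 := by norm_num
  rw [h1, Nat.testBit_two_pow_sub_one]
  exact decide_eq_true (by have := code_lt S; norm_num at this; exact this)

/-- **Every increasing pattern event of `2^4` carries a transport certificate at every parameter vector.** [this work] -/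
theorem exists_transportCert_four (q : Fin 4 → unitInterval) {P : Set (Set (Fin 4))} (hP : IsUpperSet P) : ∃ Kr, TransportCert q P Kr := by
  have hM := encA_mem_upsN' hP
  have hc := List.all_eq_true.1 cover4 _ hM
  simp only [Bool.or_eq_true, decide_eq_true_eq] at hc
  have hPM := encA_spec P
  rcases hc with (((((((h0 | h1) | hA) | hB) | hC) | hD) | hE) | hF) | hK
  · rw [eq_empty_of_encA_eq_zero h0]; exact ⟨_, transportCert_empty q⟩
  · rw [eq_univ_of_encA_eq_full h1]; exact ⟨_, transportCert_univ q⟩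
  · exact transportCert_of_checkTab (checkTab4_of_mem_batchA hA) hPM q
  · exact transportCert_of_checkTab (checkTab4_of_mem_batchB hB) hPM q
  · exact transportCert_of_checkTab (checkTab4_of_mem_batchC hC) hPM q
  · exact transportCert_of_checkTab (checkTab4_of_mem_batchD hD) hPM q
  · exact transportCert_of_checkTab (checkTab4_of_mem_batchE hE) hPM q
  · exact transportCert_of_checkTab (checkTab4_of_mem_batchF hF) hPM q
  · exact transportCert_of_checkTab3 (checkTab3_of_mem_batch4K22 hK) hPM q

omit [Fintype ι] in
/-- An embedding of `Fin 4` onto a four-element finset. [this work] -/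
theorem exists_embedding_of_card_eq_four {A : Finset ι} (hA : A.card = 4) : ∃ e : Fin 4 ↪ ι, Set.range e = ↑A := by
  have hcard : Fintype.card A = 4 := by rw [Fintype.card_coe]; exact hA
  let f : Fin 4 ≃ A := (Fintype.equivFinOfCardEq hcard).symm
  refine ⟨f.toEmbedding.trans (Function.Embedding.subtype _), ?_⟩
  ext x
  simp only [Set.mem_range, Finset.mem_coe]
  constructor
  · rintro ⟨i, rfl⟩; exact (f i).2
  · intro hx; exact ⟨f.symm ⟨x, hx⟩, by simp⟩

/-- **KAHN'S CONJECTURE 5 / SAHI'S `C₃` WHENEVER ONE SLOT DEPENDS ON AT MOST FOUR COORDINATES.**  For `|A| ≤ 4`, `H` increasing and determined by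
`A`, and ALL increasing `U, V`: `E₃(1_H, 1_U, 1_V) ≥ 0`, in every dimension. [this work] -/
theorem sahiE_three_nonneg_of_determinedBy_card_le_four (p : ι → unitInterval) (A : Finset ι) (hA : A.card ≤ 4) {H : Set (Set ι)}
    (hH : DeterminedBy H (↑A : Set ι)) (hHu : IsUpperSet H) {U V : Set (Set ι)} (hU : IsUpperSet U) (hV : IsUpperSet V) :
    0 ≤ sahiE (bernoulliWeight p) 3 ![ind H, ind U, ind V] := by
  by_cases hι : Fintype.card ι < 4
  · have hA3 : A.card ≤ 3 := by have := Finset.card_le_univ A; omega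
    exact sahiE_three_nonneg_of_determinedBy_card_le_three p A hA3 hH hHu hU hV
  · obtain ⟨A', hAA', -, hA'⟩ := Finset.exists_subsuperset_card_eq (Finset.subset_univ A) hA (by rw [Finset.card_univ]; omega)
    obtain ⟨e, he⟩ := exists_embedding_of_card_eq_four hA'
    have hH' : DeterminedBy H (Set.range e) := by rw [he]; exact hH.mono (Finset.coe_subset.2 hAA')
    obtain ⟨Kr, hKr⟩ := exists_transportCert_four (pk e p) (isUpperSet_pat e hHu)
    exact sahiE_three_nonneg_of_transportCert p e hH' hKr hU hV

/-- Law form: `0 ≤ sahiE3 (prodBernoulli p) H U V` whenever `H` is increasing and determined by at most four coordinates and `U, V` are increasing.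
[this work] -/
theorem prodBernoulli_sahiE3_nonneg_of_determinedBy_card_le_four (p : ι → unitInterval) (A : Finset ι) (hA : A.card ≤ 4)
    {H : Set (Set ι)} (hH : DeterminedBy H (↑A : Set ι)) (hHu : IsUpperSet H) {U V : Set (Set ι)} (hU : IsUpperSet U)
    (hV : IsUpperSet V) : 0 ≤ sahiE3 (prodBernoulli p) H U V := by
  rw [← sahiE_three_ind]; exact sahiE_three_nonneg_of_determinedBy_card_le_four p A hA hH hHu hU hV

end Summit.CriticalPhenomena.PercolationContinuityZ3.Theorems.SahiTransportJR
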